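import Summits.QuantumFields.YangMills.Theorems.BalabanUVNodesN07LaplaceAOfRecordFlatForm
import Summits.QuantumFields.YangMills.Theorems.BalabanUVNodesK0Stub1FlatAveragingDictionary
import Literature.MathematicalPhysics.QuantumFieldTheory.Balaban1983to89.Node00.BgGaugeLetterOfRecord
import HarnessLib

/-!
# NODE N07 — `hpos` AT THE FLAT BACKGROUND FOR THE (1.55)-CONSISTENT SITE LETTER `Q′♭ λ = λ ∘ embIter k` (node00-def-Y's ROAD (ii), bus 2026-08-31):
# the gauge-fixed flat Hessian `Δ_{1,a}(1) = D*D + D R♭ D* + a Q(1)*Q(1)` of record — `Q(1) := QOfRecord F N k 1` (the (0.4)-linearised bond averaging), `R♭` the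
# orthogonal projection onto `Δ N(Q′♭)` — IS POSITIVE DEFINITE: [B9] Thm 3.11 at `U₀ = 1` by [B5] p.30's Hodge argument (lit ✓`laplaceALatticeK_pos_of_hodge`)

Cell `pub-ymgap`, width seat `pub-ymgap-dag-n07-w3` (g24), CLAIM-3.  `--kind proof --supports stmt-QuantumFields-27238 --as helper`; count-neutral.
[B5] = [Balaban1984PropagatorsI]; [B7] = [Balaban1985Averaging]; [B9] = [Balaban1985BackgroundPropagators]; [15] = [Balaban1985Variational].

WHY.  def-Y's M1 road pins [15] (110)'s `Δ_{1,a}(U₀) = Δ₁ + D R D* + Q*(aQ)` at the record (✓p812960 `laplaceAOfRecord`) with the two averaging letters `Q`, `Q′` as data, then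
pins `Q := QOfRecord F N k U₀` (✓p814239, print's (44): the linearised `k`-fold (0.4) averaging OF RECORD) and — ROAD (ii), bus 2026-08-31 — the site letter
`Q′♭ := QflatOfRecord F N k`, `Q′♭ λ = λ ∘ embIter k` (✓p816225 `Node00/BgGaugeLetterOfRecord`): the linearisation of the coarse gauge map `u ↦ u ∘ embIter k` under which the
record's averaging is covariant (`T4Continuum.iter_gaugeAct`), i.e. the letter for which [B5] (1.55) «Q_k∂ = ∂₁Q′_k» holds for THIS `Q`.  The handle `frakGOfRecordAtBgFlat … U₀ a hpos hQ`
displays `hpos : ∀ x ≠ 0, 0 < re⟪x, laplaceAOfRecord F N k U₀ (QOfRecord F N k U₀) (QflatOfRecord F N k) a x⟫` ([B9] Thm 3.11 at the record).  THIS FILE DISCHARGES `hpos` AT THE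
FLAT BACKGROUND `U₀ = 1`, by [B5] p.30's Hodge argument in lit's abstract form ✓`B5Eq172HodgePositivity.laplaceALatticeK_pos_of_hodge` (hypotheses (H0)–(H5)), whose letter-independent
members (H0) `Δ₁(1) = D*D ≥ 0`, (H1) Poincaré on the record's fine torus and (H3) «Q(1)A₀ = A₀» were landed in ✓p816247 `…N07LaplaceAOfRecordFlatForm`; here (H2), (H4), (H5) and the assembly.

WHAT IS PROVED (sorry-free; no definition; axioms standard).
* §1 (H2): `skewField_grad` (`𝔞(∂ψ) = ∂(𝔞ψ)`), ★★ `qCplxOp_one_grad` (print's `Q_k(1)` of a fine pure gauge `∂ψ` is `L^{-k}·∂(ψ ∘ embIter k)` — k0-s1-w1 ✓`dIterL_one_grad` ([B7] (11))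
  on the two skew parts + `skewField_decomp`; generic `P`), `bondFieldIn_covDerivL2K_one` (the read-in of `D(1)l` is `η_k⁻¹·∂(read-in of l)`), ★★ `QOfRecord_one_covDerivL2K`
  ([B5] (1.55) AT THE RECORD: `Q(1)(D(1)l) = ∂♭(Q′♭ l)` with the explicit coarse flat gradient `∂♭ω = (c ↦ η_k⁻¹L^{-k}(ω(c₊) − ω(c₋)))` in def-Y's slot type).
* §2 (H4)/(H5): `sum_pbond_eq`, ★ `inner_grad_coarseConst` (`⟨∂♭ω, coarse constant⟩ = 0`: translation invariance of `Σ` over `T^{(k)}`, `LatticeFieldCalculus.shiftEquiv`),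
  ★ `const_of_grad_eq_zero` (`∂♭ω = 0 ⇒ ω` constant: dag-n12 ✓`N12FlatFibreNullSpace.const_of_shift_eq`).
* §3 ★★★ `laplaceAOfRecord_one_flat_pos` — **`0 < re⟪x, laplaceAOfRecord F N k 1 (QOfRecord F N k 1) (QflatOfRecord F N k) a x⟫` for `x ≠ 0`, `a > 0`**: the displayed `hpos` of
  `frakGOfRecordAtBgFlat F N K k Ω 1 a hpos hQ` ∕ `H1OfRecordAtBgFlat … 1 …` DISCHARGED (its `hQ` is ✓p815831 `N07QOfRecordFlatOnto.QOfRecord_one_surjective`) — every `k`, every volume.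

HONEST SCOPE.  FLAT background only ([B9] Thm 3.11's small-field statement `Δ_a(U₀)`, `U₀` in (14), is the perturbation (3.86) one storey up — NE9's `coercive_of_sub_le` shape — NOT
here); the site letter is def-Y's ROAD-(ii) `QflatOfRecord` (print's (3.18)∕[B7] (78) transported block-mean letter `QprimeOfRecord` stays pinned as typed; for THAT pair (1.55) fails
and `hpos(1)` is the size-L alternating-sum lemma of this seat's census — not here); positivity only, NO coercivity constant ((117)'s `B₀`∕[B5] (1.90)'s k-uniform γ are b05∕NE9's, not
here).  Nothing of [B5]∕[B7]∕[B9]∕[15] asserted beyond these kernel-checked lattice identities; P0 OPEN; N07 NOT discharged; K0ᴬ∕K1ᴬ∕K3ᴬ OPEN; counts unmoved (28∕28 · 8∕28 · K 1∕4);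
one finite 𝕋⁴ programme at fixed ε — R4 closes the conditional finite-𝕋⁴ rung `BalabanLadder.UV` only, never the summit; nothing continuum ∕ ℝ⁴ ∕ OS; the Yang–Mills mass gap (Clay)
is NOT proved by any of this.  No `sorry`, no `def`, no `instance`, no `notation`.

References: [B5] (1.55) p.27, (1.57) p.27, (1.69) p.29, (1.72) p.30; [B7] (11) p.18, (78)–(81) p.30; [B9] (3.3) p.391, (3.8) p.392, (3.13)–(3.19) p.393, (3.21)–(3.26) pp.394–395,
Thm 3.11 p.416; [15] (4) p.278, (44)–(45) p.285, (110)–(111) p.294, (116)–(117) p.295.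
-/

set_option autoImplicit false

noncomputable section

open scoped InnerProductSpace ComplexConjugate Matrix BigOperators

namespace Summit.QuantumFields.YangMills.Theorems.N07LaplaceAOfRecordFlatPos

open Literature.MathematicalPhysics.QuantumFieldTheory.Balaban1983to89
open Literature.MathematicalPhysics.QuantumFieldTheory.Balaban1983to89.T4Continuum (T4Family)
open B4Sect5Torus (TSite)
open B9SectCLatticeCarrier (Bond)
open B9Eq311L2Pairing (WL2)
open B9Eq310HessianOperator (adTransportW principalOpK covCurlL2K)
open B11Eq103H1Complex (SiteL2K BondL2K covDerivL2K covDivL2K equiv_covDerivL2K)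
open B9Eq33CovDerivVector (covDeriv_apply)
open B5Eq172HodgePositivity (laplaceALatticeK_pos_of_hodge re_inner_principalOpK_one covCurlL2K_eq_zero_of_re_inner_principalOpK_one)
open B5Eq172PoincareTorus (constBond constBondL2K equiv_constBondL2K constBond_apply covDerivL2K_const)
open B15DeterminingSets (embIter)
open LatticeFieldCalculus (shiftEquiv)
open Node00
open Summit.QuantumFields.YangMills.Theorems.K0Stub1FlatAveragingDictionary (dIterL_one_grad)
open Summit.QuantumFields.YangMills.Theorems.N07QOfRecordFlatOnto (qSkewOp_one_apply skewField_conjTranspose)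
open Summit.QuantumFields.YangMills.BalabanUVNodes.N12FlatFibreNullSpace (const_of_shift_eq)
open Summit.QuantumFields.YangMills.Theorems.N07LaplaceAOfRecordFlatForm

variable (F : T4Family) (N : ℕ) [NeZero N] {K : ℕ} (k : ℕ)

/-! ## §1  (H2) for the (0.4)-linearised bond averaging: `Q(1)` of a fine pure gauge is `L^{-k}` times the coarse pure gauge RESTRICTED TO THE CENTRES -/

omit [NeZero N] in
/-- The skew part commutes with the fine gradient: `𝔞(∂ψ) = ∂(𝔞ψ)`. [cite: Balaban1985BackgroundPropagators, p.393 (bookkeeping)] -/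
theorem skewField_grad {ι κ n : Type*} (ψ : κ → Matrix n n ℂ) (s t : ι → κ) :
    skewField (fun b : ι => ψ (t b) - ψ (s b)) = fun b : ι => skewField ψ (t b) - skewField ψ (s b) := by
  funext b
  simp only [skewField_apply, Matrix.conjTranspose_sub, smul_sub]
  abel

/-- ★★ **(H2)'s KERNEL: print's `Q_k(1)` (def-Y's `qCplxOp k 1`) OF A FINE PURE GAUGE `∂ψ` IS `L^{-k}·∂(ψ ∘ embIter k)`** — k0-s1-w1's ✓`dIterL_one_grad` ([B7] (11): pure gauges ↦ coarse
pure gauges by restriction to the centres) on the two skew parts, recombined by `skewField_decomp`. [cite: Balaban1985Averaging, (11) p.18; Balaban1985Variational, (44) p.285; Balaban1984PropagatorsI, (1.55) p.27] -/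
theorem qCplxOp_one_grad {P : Params} (ψ : Site P 0 → Matrix (Fin N) (Fin N) ℂ) (c : PBond P k) :
    qCplxOp k (1 : GaugeField P 0 (SU N)) (fun b : PBond P 0 => ψ b.tgt - ψ b.src) c =
      ((P.L : ℂ) ^ k)⁻¹ • (ψ (embIter k c.tgt) - ψ (embIter k c.src)) := by
  have hgrad : ∀ (χ : Site P 0 → Matrix (Fin N) (Fin N) ℂ), (∀ x, (χ x)ᴴ = -χ x) →
      qSkewOp k (1 : GaugeField P 0 (SU N)) (fun b : PBond P 0 => χ b.tgt - χ b.src) c = ((P.L : ℂ) ^ k)⁻¹ • (χ (embIter k c.tgt) - χ (embIter k c.src)) := by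
    intro χ hχ
    have hχ' : ∀ x, star (χ x) = -χ x := fun x => by rw [Matrix.star_eq_conjTranspose]; exact hχ x
    rw [qSkewOp_one_apply, dIterL_one_grad hχ' k c]
  have e1 : skewField (fun b : PBond P 0 => ψ b.tgt - ψ b.src) = fun b : PBond P 0 => skewField ψ b.tgt - skewField ψ b.src :=
    skewField_grad ψ PBond.src PBond.tgt
  have e2 : skewField (-Complex.I • fun b : PBond P 0 => ψ b.tgt - ψ b.src) =
      fun b : PBond P 0 => skewField (-Complex.I • ψ) b.tgt - skewField (-Complex.I • ψ) b.src := by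
    have h : (-Complex.I • fun b : PBond P 0 => ψ b.tgt - ψ b.src) = fun b : PBond P 0 => (-Complex.I • ψ) b.tgt - (-Complex.I • ψ) b.src := by
      funext b
      simp only [Pi.smul_apply, smul_sub]
    rw [h]
    exact skewField_grad (-Complex.I • ψ) PBond.src PBond.tgt
  unfold qCplxOp
  rw [cplxOp_apply, e1, e2, Pi.add_apply, Pi.smul_apply, hgrad _ (skewField_conjTranspose ψ), hgrad _ (skewField_conjTranspose (-Complex.I • ψ))]
  have ht := congrFun (skewField_decomp ψ) (embIter k c.tgt)
  have hs := congrFun (skewField_decomp ψ) (embIter k c.src)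
  simp only [Pi.add_apply, Pi.smul_apply] at ht hs
  rw [← ht, ← hs]
  module

/-- **The read-in of a flat covariant derivative is the fine gradient of the read-in site function, times `η_k⁻¹`** (transporters `RRec F N 1 = id`).
[cite: Balaban1985BackgroundPropagators, (3.3) pp.390-391] -/
theorem bondFieldIn_covDerivL2K_one [Fact (0 < c0Rec F K k)] (l : SiteL2K ℂ (F.P K).d (fun _ => (F.P K).sitesPerDir 0) (c0Rec F K k) (WRec N)) :
    bondFieldIn F N k (covDerivL2K ℂ (c0Rec F K k) (cRec F K k) (RRec F N (1 : GaugeField (F.P K) 0 (SU N))) l) =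
      fun b : PBond (F.P K) 0 => cRec F K k • (siteFieldIn F N k l b.tgt - siteFieldIn F N k l b.src) := by
  funext b
  rw [bondFieldIn_apply, equiv_covDerivL2K, covDeriv_apply, RRec_one, LinearMap.id_apply, btgt_bondToLit, bpos_bondToLit, map_smul, map_sub,
    siteFieldIn_apply, siteFieldIn_apply]

/-- ★★ **(H2) AT THE RECORD** ([B5] (1.55) «Q_k∂ = ∂₁Q′_k» for the (0.4)-linearised `Q(1)` and the centre-restriction site letter): for every site function `l`,
`Q(1)(D(1) l) = ∂♭(l ∘ embIter k)` with the coarse flat gradient `∂♭ ω := (c ↦ η_k⁻¹·L^{-k}·(ω(c₊) − ω(c₋)))` read in def-Y's slot type.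
[cite: Balaban1984PropagatorsI, (1.55) p.27; Balaban1985Averaging, (11) p.18; Balaban1985BackgroundPropagators, (3.13) p.393] -/
theorem QOfRecord_one_covDerivL2K [Fact (0 < c0Rec F K k)] (l : SiteL2K ℂ (F.P K).d (fun _ => (F.P K).sitesPerDir 0) (c0Rec F K k) (WRec N)) :
    QOfRecord F N k (1 : GaugeField (F.P K) 0 (SU N)) (covDerivL2K ℂ (c0Rec F K k) (cRec F K k) (RRec F N (1 : GaugeField (F.P K) 0 (SU N))) l) =
      (WL2.equiv ℂ (wBRec F K k) (WRec N)).symm fun c : PBond (F.P K) k =>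
        (phiRec N).symm ((cRec F K k * (((F.P K).L : ℂ) ^ k)⁻¹) •
          (siteFieldIn F N k l (embIter k c.tgt) - siteFieldIn F N k l (embIter k c.src))) := by
  apply (WL2.equiv ℂ (wBRec F K k) (WRec N)).injective
  funext c
  rw [QOfRecord_apply, Equiv.apply_symm_apply, bondFieldIn_covDerivL2K_one]
  have hsm : (fun b : PBond (F.P K) 0 => cRec F K k • (siteFieldIn F N k l b.tgt - siteFieldIn F N k l b.src)) =
      cRec F K k • fun b : PBond (F.P K) 0 => siteFieldIn F N k l b.tgt - siteFieldIn F N k l b.src := rfl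
  rw [hsm, map_smul, Pi.smul_apply, qCplxOp_one_grad, smul_smul]

/-! ## §2  (H4)/(H5): the coarse flat gradient is orthogonal to the coarse constants, and kills only constants -/

omit [NeZero N] in
/-- A sum over the record's level-`j` bonds is a double sum over sites and directions. [folklore] -/
theorem sum_pbond_eq {P : Params} {j : ℕ} {α : Type*} [AddCommMonoid α] (G : PBond P j → α) :
    ∑ b : PBond P j, G b = ∑ x : Site P j, ∑ μ : Fin P.d, G ⟨x, μ⟩ :=
  calc ∑ b : PBond P j, G b = ∑ p : Site P j × Fin P.d, G (LatticeFieldCalculus.bondEquiv p) :=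
        (Equiv.sum_comp (LatticeFieldCalculus.bondEquiv (P := P) (j := j)) G).symm
    _ = ∑ x : Site P j, ∑ μ : Fin P.d, G ⟨x, μ⟩ := Fintype.sum_prod_type _

omit [NeZero N] in
/-- ★ **(H4) AT THE RECORD: a coarse gradient is orthogonal to every coarse constant vector function** in def-Y's slot type (`Σ_x (g(x + e_μ) − g(x)) = 0` on the torus
`T^{(k)}`, translation invariance of the sum). [cite: Balaban1984PropagatorsI, p.27, (1.72) p.30] -/
theorem inner_grad_coarseConst [Fact (∀ c, 0 < wBRec F K k c)] (s : ℂ) (ω : Site (F.P K) k → Matrix (Fin N) (Fin N) ℂ) (v : Fin (F.P K).d → WRec N) :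
    ⟪(WL2.equiv ℂ (wBRec F K k) (WRec N)).symm fun c : PBond (F.P K) k => (phiRec N).symm (s • (ω c.tgt - ω c.src)),
      (WL2.equiv ℂ (wBRec F K k) (WRec N)).symm fun c : PBond (F.P K) k => v c.dir⟫_ℂ = 0 := by
  rw [WL2.inner_def]
  simp only [Equiv.apply_symm_apply]
  rw [sum_pbond_eq, Finset.sum_comm]
  refine Finset.sum_eq_zero fun μ _ => ?_
  have hsplit : ∀ x : Site (F.P K) k,
      ⟪(phiRec N).symm (s • (ω (PBond.tgt ⟨x, μ⟩) - ω x)), v μ⟫_ℂ =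
        ⟪(phiRec N).symm (s • ω (x.shift μ)), v μ⟫_ℂ - ⟪(phiRec N).symm (s • ω x), v μ⟫_ℂ := fun x => by
    rw [← inner_sub_left, ← map_sub, ← smul_sub]
    rfl
  have hshift : ∑ x : Site (F.P K) k, ⟪(phiRec N).symm (s • ω (x.shift μ)), v μ⟫_ℂ = ∑ x : Site (F.P K) k, ⟪(phiRec N).symm (s • ω x), v μ⟫_ℂ :=
    Equiv.sum_comp (shiftEquiv (P := F.P K) (j := k) μ) (fun x => ⟪(phiRec N).symm (s • ω x), v μ⟫_ℂ)
  unfold wBRec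
  simp only [hsplit]
  rw [← Finset.mul_sum, Finset.sum_sub_distrib, hshift, sub_self, mul_zero]

omit [NeZero N] in
/-- ★ **(H5) AT THE RECORD, first half: a coarse function with vanishing flat gradient is constant** (dag-n12 ✓`const_of_shift_eq`: the torus `T^{(k)}` is connected by unit
translations). [cite: Balaban1984PropagatorsI, p.22] -/
theorem const_of_grad_eq_zero (ω : Site (F.P K) k → Matrix (Fin N) (Fin N) ℂ) (h : ∀ c : PBond (F.P K) k, ω c.tgt - ω c.src = 0) (y y' : Site (F.P K) k) :
    ω y = ω y' := by
  rw [const_of_shift_eq ω (fun x μ => sub_eq_zero.1 (h ⟨x, μ⟩)) y, const_of_shift_eq ω (fun x μ => sub_eq_zero.1 (h ⟨x, μ⟩)) y']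

/-! ## §3  THE ASSEMBLY: `hpos` of def-Y's `frakGOfRecordAtBgFlat … 1 …` ∕ `H1OfRecordAtBgFlat … 1 …` DISCHARGED -/

/-- ★★★ **[B9] THM 3.11 AT THE FLAT BACKGROUND FOR THE RECORD's LETTERS (Q := the (0.4)-linearised averaging `QOfRecord F N k 1`, Q′♭ := `QflatOfRecord F N k`):
`Δ_{1,a}(1) = D*D + D R♭ D* + a Q(1)*Q(1)` IS POSITIVE DEFINITE** — `0 < re⟪x, laplaceAOfRecord F N k 1 (QOfRecord F N k 1) (QflatOfRecord F N k) a x⟫` for `x ≠ 0`, `a > 0`: the displayed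
`hpos` of def-Y's ✓`Node00.frakGOfRecordAtBgFlat` ∕ `H1OfRecordAtBgFlat` at `U₀ = 1`, DISCHARGED.  Proof = [B5] p.30 («so A = 0 and the positivity of Δ_a follows») through lit's
✓`B5Eq172HodgePositivity.laplaceALatticeK_pos_of_hodge`: (H0) `Δ₁(1) = D*D ≥ 0` (✓p816247 `hessOpOfRecord_one` + lit), (H1) Poincaré on the record's torus (✓p816247), (H2) §1
`QOfRecord_one_covDerivL2K`, (H3) ✓p816247 `QOfRecord_one_constBond` ∕ `eq_zero_of_QOfRecord_one_constBond_eq_zero`, (H4) §2 `inner_grad_coarseConst`, (H5) §2 `const_of_grad_eq_zero` + lit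
`covDerivL2K_const`. [cite: Balaban1985BackgroundPropagators, Thm 3.11 p.416, (3.26) p.395; Balaban1984PropagatorsI, (1.72) p.30, (1.55) p.27; Balaban1985Variational, (110) p.294, (116)-(117) p.295] -/
theorem laplaceAOfRecord_one_flat_pos [Fact (0 < c0Rec F K k)] [Fact (∀ c, 0 < wBRec F K k c)] {a : ℝ} (ha : 0 < a)
    (x : BondL2K ℂ (F.P K).d (fun _ => (F.P K).sitesPerDir 0) (c0Rec F K k) (WRec N)) (hx : x ≠ 0) :
    0 < RCLike.re ⟪x, laplaceAOfRecord F N k (1 : GaugeField (F.P K) 0 (SU N)) (QOfRecord F N k (1 : GaugeField (F.P K) 0 (SU N)))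
      (QflatOfRecord F N k) a x⟫_ℂ := by
  have hc := conj_cRec F K k
  have hRS := inner_RRec_left (F := F) (N := N) (K := K) (1 : GaugeField (F.P K) 0 (SU N))
  -- the coarse constants and the coarse flat gradient, as linear maps into def-Y's slot type
  let coarseConst : (Fin (F.P K).d → WRec N) →ₗ[ℂ] WL2 ℂ (wBRec F K k) (WRec N) :=
    (WL2.linearEquiv ℂ ℂ (wBRec F K k)).symm.toLinearMap ∘ₗ LinearMap.funLeft ℂ (WRec N) (PBond.dir : PBond (F.P K) k → Fin (F.P K).d)
  have coarseConst_apply : ∀ v, coarseConst v = (WL2.equiv ℂ (wBRec F K k) (WRec N)).symm fun c : PBond (F.P K) k => v c.dir := fun _ => rfl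
  let gradM : (Site (F.P K) k → Matrix (Fin N) (Fin N) ℂ) →ₗ[ℂ] (PBond (F.P K) k → Matrix (Fin N) (Fin N) ℂ) :=
    LinearMap.pi fun c : PBond (F.P K) k =>
      LinearMap.proj (R := ℂ) (φ := fun _ : Site (F.P K) k => Matrix (Fin N) (Fin N) ℂ) c.tgt -
        LinearMap.proj (R := ℂ) (φ := fun _ : Site (F.P K) k => Matrix (Fin N) (Fin N) ℂ) c.src
  have gradM_apply : ∀ ω c, gradM ω c = ω c.tgt - ω c.src := fun _ _ => rfl
  let dC : (Site (F.P K) k → Matrix (Fin N) (Fin N) ℂ) →ₗ[ℂ] WL2 ℂ (wBRec F K k) (WRec N) :=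
    bondFieldOut F N k ∘ₗ ((cRec F K k * (((F.P K).L : ℂ) ^ k)⁻¹) • gradM)
  have dC_apply : ∀ ω, dC ω = (WL2.equiv ℂ (wBRec F K k) (WRec N)).symm fun c : PBond (F.P K) k =>
      (phiRec N).symm ((cRec F K k * (((F.P K).L : ℂ) ^ k)⁻¹) • (ω c.tgt - ω c.src)) := by
    intro ω
    apply (WL2.equiv ℂ (wBRec F K k) (WRec N)).injective
    funext c
    rw [Equiv.apply_symm_apply]
    show WL2.equiv ℂ _ _ (bondFieldOut F N k (((cRec F K k * (((F.P K).L : ℂ) ^ k)⁻¹) • gradM) ω)) c = _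
    rw [bondFieldOut_apply, LinearMap.smul_apply, Pi.smul_apply, gradM_apply]
  unfold laplaceAOfRecord RrOfRecord
  refine laplaceALatticeK_pos_of_hodge (cRec F K k) hc (RRec F N (1 : GaugeField (F.P K) 0 (SU N))) (SRec F N (1 : GaugeField (F.P K) 0 (SU N))) hRS
    (hessOpOfRecord F N k (1 : GaugeField (F.P K) 0 (SU N))) (QOfRecord F N k (1 : GaugeField (F.P K) 0 (SU N))) (QflatOfRecord F N k) a
    (Harm := LinearMap.range (constBondL2K (fun _ : Fin (F.P K).d => (F.P K).sitesPerDir 0) ℂ (c0Rec F K k)))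
    (HarmC := LinearMap.range coarseConst) (dC := dC) ?_ ?_ ?_ ?_ ?_ ?_ ?_ ha x hx
  · -- (H0): `re⟪x, Δ₁(1)x⟫ = ‖D(1)x‖² ≥ 0`
    intro y
    rw [hessOpOfRecord_one, re_inner_principalOpK_one]
    positivity
  · -- (H1): Poincaré on the record's fine torus
    intro y hy
    rw [hessOpOfRecord_one] at hy
    have hcurl := covCurlL2K_eq_zero_of_re_inner_principalOpK_one (phiRec N) ((F.P K).eta k) hy
    have hR : RRec F N (1 : GaugeField (F.P K) 0 (SU N)) =
        adTransportW (phiRec N) (fun _ : Bond (F.P K).d (fun _ => (F.P K).sitesPerDir 0) => (1 : (Matrix (Fin N) (Fin N) ℂ)ˣ)) := by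
      unfold RRec
      rw [unitsOfRecord_one]
    have hcurl' : covCurlL2K ℂ (c0Rec F K k) (cRec F K k) (RRec F N (1 : GaugeField (F.P K) 0 (SU N))) y = 0 := by
      rw [hR, cRec]
      exact hcurl
    exact exists_covDeriv_add_const_of_covCurl_one F N k y hcurl'
  · -- (H2): `Q(1) ∘ D(1) = dC ∘ Q′♭`
    apply LinearMap.ext
    intro l
    rw [LinearMap.comp_apply, LinearMap.comp_apply, QOfRecord_one_covDerivL2K, dC_apply]
    rfl
  · -- (H3) first half: constants ↦ coarse constants
    rintro _ ⟨v, rfl⟩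
    exact ⟨v, by rw [coarseConst_apply, QOfRecord_one_constBond]⟩
  · -- (H3) second half: injectively
    rintro _ ⟨v, rfl⟩ h0
    rw [eq_zero_of_QOfRecord_one_constBond_eq_zero F N k h0, map_zero]
  · -- (H4): coarse gradients ⊥ coarse constants
    rintro ω _ ⟨v, rfl⟩
    rw [dC_apply, coarseConst_apply]
    exact inner_grad_coarseConst F N k _ ω v
  · -- (H5): a coarse function with vanishing gradient lifts to a fine constant in `ker D(1)`
    intro ω hω
    have hgrad : ∀ c : PBond (F.P K) k, ω c.tgt - ω c.src = 0 := by
      intro c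
      have hc0 := congrFun (congrArg (WL2.equiv ℂ (wBRec F K k) (WRec N)) ((dC_apply ω).symm.trans hω)) c
      rw [Equiv.apply_symm_apply, WL2.equiv_zero, Pi.zero_apply, LinearEquiv.map_eq_zero_iff, smul_eq_zero] at hc0
      rcases hc0 with h | h
      · exfalso
        have hL : (((F.P K).L : ℂ) ^ k)⁻¹ ≠ 0 := inv_ne_zero (pow_ne_zero _ (Nat.cast_ne_zero.mpr (F.P K).L_pos.ne'))
        have hcR : cRec F K k ≠ 0 := by
          rw [cRec]
          exact inv_ne_zero (Complex.ofReal_ne_zero.2 (factEta F K k).out.ne')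
        exact mul_ne_zero hcR hL h
      · exact h
    obtain y₀ : Site (F.P K) k := fun _ => 0
    refine ⟨(WL2.equiv ℂ (fun _ : TSite (F.P K).d (fun _ => (F.P K).sitesPerDir 0) => c0Rec F K k) (WRec N)).symm fun _ => (phiRec N).symm (ω y₀),
      covDerivL2K_const (𝕜 := ℂ) (cRec F K k) (RRec_one F N) _, ?_⟩
    funext y
    rw [QflatOfRecord_apply, siteFieldIn_apply, Equiv.apply_symm_apply, LinearEquiv.apply_symm_apply]
    exact (const_of_grad_eq_zero F N k ω hgrad y y₀).symm

end Summit.QuantumFields.YangMills.Theorems.N07LaplaceAOfRecordFlatPos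

end
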